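import Literature.NumberTheory.Sieve.ParityWave0
import Literature.NumberTheory.Sieve.PretentiousDistance
import HarnessLib

/-!
# Matomäki–Radziwiłł, *Multiplicative functions in short intervals* (Ann. Math. 183 (2016))

Trunk AntSieve / family `parity`, topic `Literature/NumberTheory/Sieve`.  This file is the
top layer of the decomposition of the named fact `Literature.NumberTheory.Sieve.matomaki_radziwill`
(**parity.S38**, `ParityWave0.lean`), which is the *qualitative* form of Theorem 1 of the paper.

## Content

* `MatomakiRadziwill2016_theorem1` — NAMED FACT: Theorem 1 as printed (quantitative form, with
  its two absolute constants `C, C' > 1`, real parameters `2 ≤ h ≤ X`, `δ > 0`, and the printed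
  exceptional-set bound `C X ((log h)^{1/3} / (δ² h^{δ/25}) + 1 / (δ² (log X)^{1/50}))`).
* `matomaki_radziwill_of_theorem1` — PROVED: Theorem 1 (quantitative) implies the vendored
  qualitative statement `Literature.NumberTheory.Sieve.matomaki_radziwill` (choose `δ = ε/4`; the endpoint terms
  `f(x)/h`, `f(X)/X` by which the closed sums of the paper differ from the half-open sums of
  `matomaki_radziwill`, and the correction `C' log log h / log h`, are each eventually `< ε/4`;
  the exceptional-set bound divided by `X` tends to `0` because `h → ∞`).
* `minPretentiousDistSq f x T` — glue: `M(x, T) = min_{|t| ≤ T} 𝔻(f, n^{it}; x)²` over the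
  Literature definition `Literature.NumberTheory.Sieve.pretentiousDistSq` (an `iInf` over the compact `t ∈ [-T, T]`).
* `halaszMontgomeryTenenbaum` — NAMED FACT (Halász's theorem in the Halász–Montgomery–Tenenbaum
  form, as printed in Mangerel 2018, Thm 1.1.5, quoting Tenenbaum, Thm III.4.6): for `x ≥ 3`, `T ≥ 1`
  and multiplicative `|f| ≤ 1`, `|∑_{n≤x} f(n)| ≪ x (1 + M) e^{-M} + x/√T`, `M = M(x, T)`.  This is the
  input behind the paper's Lemmas 1–4 (its Lemma 1 is printed with `M e^{-M}` in place of
  `(1 + M) e^{-M}`, a misprint: `f ≡ 1` has `M = 0`; the paper only uses it for large `M`).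
* `MatomakiRadziwill2016_lemma4` — NAMED FACT (Lemma 4, Lipschitz estimate "due to Granville and
  Soundararajan"): for `x ∈ [X, 2X]`, `X/(log X)^{1/5} ≤ y ≤ X`,
  `(1/y) ∑_{x≤n≤x+y} f(n) = (1/X) ∑_{X≤n≤2X} f(n) + O((log X)^{-1/20})`.
* `MatomakiRadziwill2016_lemma14_real` — NAMED FACT (Lemma 14, the Parseval bound, for a **real**
  sequence `|a_m| ≤ 1`): the mean square over `x ∈ [X, 2X]` of `S₁(x)/h₁ - S₂(x)/h₂`
  (`S_j(x) = ∑_{x≤m≤x+h_j} a_m`, `1 ≤ h₁ ≤ h₂ = X/(log X)^{1/5}`) is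
  `≪ (log X)^{-2/15} + ∫_{(log X)^{1/15}}^{X/h₁} |A(1+it)|² dt + max_{T ≥ X/h₁} (X/h₁)/T ∫_T^{2T} |A(1+it)|² dt`,
  `A(s) = ∑_{X≤m≤4X} a_m m^{-s}`.  This is the faithful rendering and it is PROVED downstream:
  `MatomakiRadziwill2016_lemma14_real_holds` (`MatomakiRadziwillLemma14.lean`).  Two earlier
  renderings are **DEPRECATED** (2026-08-15 verdict clean-up: `@[deprecated]`, statements kept
  verbatim as the literal record and as the subjects of their refutations):
  `MatomakiRadziwill2016_lemma14` (mis-parenthesised: its first `∫ dt` swallows the `max` term) and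
  `MatomakiRadziwill2016_lemma14_parseval` (correctly parenthesised); **both quantify over complex
  sequences `a : ℕ → ℂ`, an over-generalisation of the printed "Let `|a_m| ≤ 1`" under which the
  one-sided right-hand side (frequencies `t ≥ (log X)^{1/15}` only) no longer controls the left-hand
  side, and both are REFUTED in tree**: `MatomakiRadziwill2016_lemma14_parseval_false :
  ¬ MatomakiRadziwill2016_lemma14_parseval` (`MatomakiRadziwillLemma14Refutation.lean`, sharp twist
  `a_m = m^{-iM⁴}`) and `MatomakiRadziwill2016_lemma14_false : ¬ MatomakiRadziwill2016_lemma14`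
  (`MatomakiRadziwillLemma14SmoothRefutation.lean`, smoothly weighted twist).  Never take either as a
  hypothesis (anything follows); every use of the two names now raises a deprecation warning pointing
  at `MatomakiRadziwill2016_lemma14_real`.  The two implications
  `MatomakiRadziwill2016_lemma14_of_parseval` (parseval → mis-parenthesised) and
  `MatomakiRadziwill2016_lemma14_real_of_parseval` (parseval → real, by specialisation) are proved but
  vacuous (refuted hypothesis) and likewise deprecated.
* `SieveIntervalSystem η X` — DEFINITION (§2): a system of intervals `[P_j, Q_j]`, `j ≥ 1`, with the
  spacing conditions (2), (3) of the paper and the index `J` (largest `j` with `Q_j ≤ exp(√log X)`);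
  `SieveIntervalSystem.Mem` is the predicate "`n ∈ 𝒮`" (a prime factor in each `[P_j, Q_j]`,
  `j ≤ J`), `SieveIntervalSystem.Avoids 𝒥` / `SieveIntervalSystem.g 𝒥` the support condition and
  the completely multiplicative function `g_𝒥` of Lemma 5 (`isMultiplicative_g`).
* `MatomakiRadziwill2016_lemma5` (= `SieveIntervalSystem.sum_filter_mem_eq_real`, and the
  vector-valued `sum_filter_mem_eq`) — PROVED: Lemma 5, the inclusion–exclusion identity
  `∑_{n ∈ 𝒮} a_n = ∑_{𝒥 ⊆ {1,…,J}} (-1)^{#𝒥} ∑ g_𝒥(n) a_n`.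
* `MatomakiRadziwill2016_theorem3` — NAMED FACT: Theorem 3 (the mean-square form of Theorem 1 on
  `𝒮`, bound `(log h)^{1/3}/P_1^{1/6-η} + (log X)^{-1/50}`).
* `MatomakiRadziwill2016_prop1` — NAMED FACT: Proposition 1 (the main Dirichlet-polynomial bound
  `∫_{(log X)^{1/15}}^{T} |F(1+it)|² dt ≪ (T Q_1/X + 1)((log Q_1)^{1/3}/P_1^{1/6-η} + (log X)^{-1/50})`).

The Dirichlet-polynomial toolkit of §4 of the paper (Lemmas 6, 7, 9, 10 and the proved weak mean
value theorem) is in `Literature/NumberTheory/LFunctions/DirichletPolynomialMeanValue.lean`.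

## Faithfulness notes

* Theorem 1 is printed for real `2 ≤ h ≤ X`; the exceptional `x` are the *integers* of `[X, 2X]`,
  i.e. `x ∈ Finset.Icc ⌈X⌉₊ ⌊2X⌋₊`, and for an integer `x` the integers of `[x, x + h]` are
  `Finset.Icc x (x + ⌊h⌋₊)`.  "Absolute constants" = independent of `f, h, X, δ` (the paper:
  "Theorem 1 allows `h, δ` and `f` to vary uniformly"), hence `∃ C C'` outermost.  The remark
  "One can take `C' = 20000`" is not part of the vendored statement.
* `f : ℕ → [-1, 1]` multiplicative is rendered, as in `matomaki_radziwill`, by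
  `f : ArithmeticFunction ℝ`, `f.IsMultiplicative`, `∀ n, |f n| ≤ 1` (the value `f 0 = 0` is never
  used: all sums run over `n ≥ x ≥ X ≥ 2`); complex `1`-bounded multiplicative functions
  (Mangerel's class `ℳ`) by `f : ArithmeticFunction ℂ`, `f.IsMultiplicative`, `∀ n, ‖f n‖ ≤ 1`.
* Integers of a real interval `[u, v]` (`u ≥ 0`) are `Finset.Icc ⌈u⌉₊ ⌊v⌋₊`.
* `O(·)` / `≪` with absolute implied constants and an implicit "X large" are rendered `∃ C X₀, ∀ X ≥ X₀`
  (Lemmas 4, 14); Halász's theorem is printed with the explicit range `x ≥ 3`, `T ≥ 1` and rendered so.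
* In Lemma 14 the printed `max_{T ≥ X/h₁}` is an `iSup` over `T ∈ Set.Ici (X/h₁)`; the family is bounded
  (by `|a_m| ≤ 1`, `(X/h₁)/T · ∫_T^{2T} |A|² ≤ (X/h₁) (log 4 + 1)²`), so no junk value arises.
* In Lemma 14 "Let `|a_m| ≤ 1`" is a **real** sequence: the lemma is applied (§9) only to
  `a_m = f(m) 1_𝒮(m)` with `f` real, and its proof splits the Perron integral at `|t| = T₀` and then
  displays only the range `t ≥ T₀`, which is legitimate exactly when `|A(1 - it)| = |A(1 + it)|`, i.e.
  for real `a_m` (arXiv:1501.04585, p. 15: "according to whether `|t| ≤ T₀` or not", after which only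
  `∫_{1+iT₀}^{1+i∞}` is displayed).  `MatomakiRadziwill2016_lemma14_real` records this reading (and
  is proved downstream); the complex-sequence renderings `MatomakiRadziwill2016_lemma14{,_parseval}`
  are refuted in tree and `@[deprecated]` (2026-08-15), kept verbatim only as the subjects of their
  refutations.
* `𝒮` (§2: "a set of integers `X ≤ n ≤ 2X` having at least one prime factor in each of the intervals
  `[P_j, Q_j]` for `j ≤ J`") is recorded as the predicate `SieveIntervalSystem.Mem` on `ℕ`; the range
  (`X ≤ n ≤ 2X`, `x ≤ n ≤ x + h`, …) is displayed in each sum, as in the paper (whose `𝒮_j` of §8 is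
  likewise used outside `[X, 2X]`).  Condition (2) is recorded with its (positive) denominator
  `log P_{j-1} - 1` cleared; "`J` is the largest index with `Q_J ≤ exp(√log X)`" is the pair
  `Q_J ≤ exp(√log X) < Q_{J+1}` (the `Q_j` increase strictly by (3)).
* Theorem 3 and Proposition 1 hold "for `X > X(η)`" with "`≪`": rendered `∀ η ∈ (0, 1/6), ∃ C X₀, …`
  (the constant may depend on `η`; the paper fixes `η = 1/150` when deducing Theorem 1).  Theorem 3
  is recorded with the bound `h ≤ X` of Theorem 1 explicit (see its docstring).

## Proof architecture of Theorem 1 (for the remaining decomposition; numbering of the paper)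

Thm 1 ⇐ Thm 3 (`MatomakiRadziwill2016_theorem3`: mean square over `x ∈ [X,2X]` of short-minus-long
averages restricted to a sieved set `𝒮` of integers with a prime factor in each `[P_j, Q_j]`) +
fundamental lemma of the sieve (density of `𝒮`) [§9]; Thm 3 ⇐ Lemma 14 (Parseval bound: short-interval variance ≪ mean square
of the Dirichlet polynomial `F(1+it)` on `(log X)^{1/15} ≤ t ≤ X/h`) + Prop. 1 (the Dirichlet
polynomial bound, `MatomakiRadziwill2016_prop1`) + Lemma 4 (Granville–Soundararajan Lipschitz
estimate) + Lemma 5 (inclusion–exclusion over `𝒮`, proved here); Prop. 1 ⇐ Lemma 12 (Ramaré-type factorisation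
`F ≈ Σ_v Q_{v,H} R_{v,H}`) + Lemma 6 (mean value theorem, IK Thm 9.1) + Lemma 13 (moment bound,
Shiu) + Lemma 8 (large values of prime polynomials) + Lemma 9 (Halász–Montgomery inequality) +
Lemma 11 (Halász inequality for primes, via duality Lemma 10 and the Vinogradov–Korobov region) +
Lemmas 1–3 (Halász's theorem in the Granville–Soundararajan form).

## Sources

* K. Matomäki, M. Radziwiłł, *Multiplicative functions in short intervals*, Ann. of Math. (2)
  183 (2016), no. 3, 1015–1056, doi:10.4007/annals.2016.183.3.6, arXiv:1501.04585; Theorem 1 is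
  on p. 1 of the introduction, its proof in §9; `𝒮`, (2), (3), Theorem 3 in §2; Lemmas 1–5 in §3;
  Lemma 14 in §7; Proposition 1 in §8.
* A. P. Mangerel, *Topics in Multiplicative and Probabilistic Number Theory*, PhD thesis, Univ. of
  Toronto (2018), Thm 1.1.5 (p. 12), quoting G. Tenenbaum, *Introduction to Analytic and
  Probabilistic Number Theory*, Thm III.4.6 (the primary source; references.bib key `Tenenbaum2015`,
  3rd ed., §III.4 — the theorem number there has not been edition-checked, so the `[cite]` tag of
  `halaszMontgomeryTenenbaum` names Mangerel's verified statement).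
-/

open Filter Asymptotics Finset Topology

namespace Literature.NumberTheory.Sieve

/-- NAMED FACT — **Matomäki–Radziwiłł, Theorem 1** (Ann. Math. 183 (2016), Thm 1, as printed):
"Let `f : ℕ → [-1,1]` be a multiplicative function. There exist absolute constants `C, C' > 1`
such that for any `2 ≤ h ≤ X` and `δ > 0`,
`|(1/h) ∑_{x ≤ n ≤ x+h} f(n) - (1/X) ∑_{X ≤ n ≤ 2X} f(n)| ≤ δ + C' (log log h)/(log h)`
for all but at most `C X ((log h)^{1/3} / (δ² h^{δ/25}) + 1 / (δ² (log X)^{1/50}))` integers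
`x ∈ [X, 2X]`."  Here `h, X` are real, `x` ranges over the integers of `[X, 2X]`
(`Finset.Icc ⌈X⌉₊ ⌊2X⌋₊`) and, `x` being an integer, `{n ∈ ℕ : x ≤ n ≤ x + h} = Icc x (x + ⌊h⌋₊)`.
The constants are absolute (independent of `f, h, X, δ`), so they are quantified outermost; the
printed remark "one can take `C' = 20000`" is not recorded.  The qualitative corollary is
`matomaki_radziwill` (see `matomaki_radziwill_of_theorem1`).
Users take `(h : MatomakiRadziwill2016_theorem1)`. [cite: MatomakiRadziwillAnnals2016, Theorem 1] -/
def MatomakiRadziwill2016_theorem1 : Prop :=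
  ∃ C C' : ℝ, 1 < C ∧ 1 < C' ∧
    ∀ f : ArithmeticFunction ℝ, f.IsMultiplicative → (∀ n, |f n| ≤ 1) →
    ∀ h X δ : ℝ, 2 ≤ h → h ≤ X → 0 < δ →
      (#{x ∈ Icc ⌈X⌉₊ ⌊2 * X⌋₊ |
          δ + C' * Real.log (Real.log h) / Real.log h <
            |h⁻¹ * ∑ n ∈ Icc x (x + ⌊h⌋₊), f n - X⁻¹ * ∑ n ∈ Icc ⌈X⌉₊ ⌊2 * X⌋₊, f n|} : ℝ)
        ≤ C * X * (Real.log h ^ (1 / 3 : ℝ) / (δ ^ 2 * h ^ (δ / 25))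
            + 1 / (δ ^ 2 * Real.log X ^ (1 / 50 : ℝ)))

/-- **Theorem 1 ⇒ parity.S38.**  The quantitative Theorem 1 of Matomäki–Radziwiłł implies the
qualitative statement `matomaki_radziwill`: for `h = h(X) → ∞`, `h ≤ X`, and `ε > 0`, the number
of integers `x ∈ [X, 2X]` with `|(1/h) ∑_{x < n ≤ x+h} f(n) - (1/X) ∑_{X < n ≤ 2X} f(n)| ≥ ε` is
`o(X)`.  Proof: apply Theorem 1 with `δ = ε/4`; the half-open sums differ from the closed ones by
`f(x)/h` and `f(X)/X`, each eventually `≤ ε/8` in absolute value, and `C' log log h / log h < ε/4`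
eventually, so every `x` counted on the left is exceptional for Theorem 1; finally
`C ((log h)^{1/3} / (δ² h^{δ/25}) + 1/(δ² (log X)^{1/50})) → 0`. [cite: MatomakiRadziwillAnnals2016, Theorem 1] -/
theorem matomaki_radziwill_of_theorem1 (hT : MatomakiRadziwill2016_theorem1) :
    matomaki_radziwill := by
  intro f hf hf1 h hh hhX ε hε
  obtain ⟨C, C', hC, -, H⟩ := hT
  have hC0 : 0 ≤ C := by linarith
  set δ : ℝ := ε / 4 with hδ
  have hδ0 : 0 < δ := by positivity
  -- real-valued divergence of `h X` and of `X`
  have hXR : Tendsto (fun X : ℕ => (X : ℝ)) atTop atTop := tendsto_natCast_atTop_atTop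
  have hhR : Tendsto (fun X => (h X : ℝ)) atTop atTop := tendsto_natCast_atTop_atTop.comp hh
  -- the exceptional-set bound of Theorem 1, divided by `X`, tends to `0`
  set g : ℕ → ℝ := fun X =>
    C * (Real.log (h X) ^ (1 / 3 : ℝ) / (δ ^ 2 * (h X : ℝ) ^ (δ / 25))
      + 1 / (δ ^ 2 * Real.log X ^ (1 / 50 : ℝ))) with hg_def
  have hg : Tendsto g atTop (𝓝 0) := by
    have h1 : Tendsto (fun X => Real.log (h X) ^ (1 / 3 : ℝ) / (δ ^ 2 * (h X : ℝ) ^ (δ / 25)))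
        atTop (𝓝 0) := by
      have := (((isLittleO_log_rpow_rpow_atTop (1 / 3 : ℝ)
        (by positivity : 0 < δ / 25)).tendsto_div_nhds_zero).comp hhR).div_const (δ ^ 2)
      rw [zero_div] at this
      refine this.congr fun X => ?_
      simp only [Function.comp_apply]
      rw [div_div, mul_comm]
    have h2 : Tendsto (fun X : ℕ => 1 / (δ ^ 2 * Real.log X ^ (1 / 50 : ℝ))) atTop (𝓝 0) := by
      simp_rw [one_div]
      refine Tendsto.inv_tendsto_atTop (Tendsto.const_mul_atTop (by positivity) ?_)
      exact (tendsto_rpow_atTop (by norm_num)).comp (Real.tendsto_log_atTop.comp hXR)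
    have := (h1.add h2).const_mul C
    rwa [add_zero, mul_zero] at this
  -- the threshold correction `C' log log h / log h` tends to `0`
  have hr : Tendsto (fun X => C' * Real.log (Real.log (h X)) / Real.log (h X)) atTop (𝓝 0) := by
    have := (Real.isLittleO_log_id_atTop.tendsto_div_nhds_zero.comp
      (Real.tendsto_log_atTop.comp hhR)).const_mul C'
    rw [mul_zero] at this
    refine this.congr fun X => ?_
    simp only [Function.comp_apply, id]
    ring
  have hinvh : Tendsto (fun X => (h X : ℝ)⁻¹) atTop (𝓝 0) := tendsto_inv_atTop_zero.comp hhR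
  have hinvX : Tendsto (fun X : ℕ => (X : ℝ)⁻¹) atTop (𝓝 0) := tendsto_inv_atTop_zero.comp hXR
  rw [isLittleO_iff]
  intro c hc
  filter_upwards [hg.eventually (eventually_le_nhds hc), hh.eventually (eventually_ge_atTop 2),
    hr.eventually (eventually_lt_nhds (show (0 : ℝ) < ε / 4 by positivity)),
    hinvh.eventually (eventually_le_nhds (show (0 : ℝ) < ε / 8 by positivity)),
    hinvX.eventually (eventually_le_nhds (show (0 : ℝ) < ε / 8 by positivity)),
    eventually_ge_atTop 1] with X hgX hh2 hrX hih hiX hX1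
  have hX0 : (0 : ℝ) < X := by exact_mod_cast hX1
  have hh0 : (0 : ℝ) < h X := by exact_mod_cast lt_of_lt_of_le (by norm_num) hh2
  -- Theorem 1 at `h := h X`, `X := X`, `δ := ε / 4`
  have hT1 := H f hf hf1 (h X) X δ (by exact_mod_cast hh2) (by exact_mod_cast hhX X) hδ0
  have e1 : ⌈((X : ℕ) : ℝ)⌉₊ = X := Nat.ceil_natCast X
  have e2 : ⌊(2 : ℝ) * (X : ℕ)⌋₊ = 2 * X := by
    rw [show (2 : ℝ) * (X : ℕ) = ((2 * X : ℕ) : ℝ) by push_cast; ring]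
    exact Nat.floor_natCast _
  have e3 : ⌊((h X : ℕ) : ℝ)⌋₊ = h X := Nat.floor_natCast _
  simp only [e1, e2, e3] at hT1
  -- every `x` counted in `matomaki_radziwill` is exceptional for Theorem 1
  have hsub :
      #{x ∈ Icc X (2 * X) | ε ≤ |(h X : ℝ)⁻¹ * ∑ n ∈ Ioc x (x + h X), f n
          - (X : ℝ)⁻¹ * ∑ n ∈ Ioc X (2 * X), f n|}
        ≤ #{x ∈ Icc X (2 * X) | δ + C' * Real.log (Real.log (h X)) / Real.log (h X) <
            |(h X : ℝ)⁻¹ * ∑ n ∈ Icc x (x + h X), f n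
              - (X : ℝ)⁻¹ * ∑ n ∈ Icc X (2 * X), f n|} := by
    refine Finset.card_le_card fun x hx => ?_
    rw [Finset.mem_filter] at hx ⊢
    refine ⟨hx.1, ?_⟩
    obtain ⟨-, hx⟩ := hx
    rw [← Finset.Ioc_insert_left (Nat.le_add_right x (h X)),
      ← Finset.Ioc_insert_left (by omega : X ≤ 2 * X),
      Finset.sum_insert (by simp), Finset.sum_insert (by simp)]
    set So : ℝ := ∑ n ∈ Ioc x (x + h X), f n
    set Lo : ℝ := ∑ n ∈ Ioc X (2 * X), f n
    have t1 : |(h X : ℝ)⁻¹ * f x| ≤ (h X : ℝ)⁻¹ := by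
      rw [abs_mul, abs_of_nonneg (inv_nonneg.mpr hh0.le)]
      exact mul_le_of_le_one_right (inv_nonneg.mpr hh0.le) (hf1 x)
    have t2 : |(X : ℝ)⁻¹ * f X| ≤ (X : ℝ)⁻¹ := by
      rw [abs_mul, abs_of_nonneg (inv_nonneg.mpr hX0.le)]
      exact mul_le_of_le_one_right (inv_nonneg.mpr hX0.le) (hf1 X)
    have key : |(h X : ℝ)⁻¹ * So - (X : ℝ)⁻¹ * Lo| ≤
        |(h X : ℝ)⁻¹ * (f x + So) - (X : ℝ)⁻¹ * (f X + Lo)|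
          + ((h X : ℝ)⁻¹ + (X : ℝ)⁻¹) := by
      calc |(h X : ℝ)⁻¹ * So - (X : ℝ)⁻¹ * Lo|
          = |((h X : ℝ)⁻¹ * (f x + So) - (X : ℝ)⁻¹ * (f X + Lo))
              - ((h X : ℝ)⁻¹ * f x - (X : ℝ)⁻¹ * f X)| := by ring_nf
        _ ≤ |(h X : ℝ)⁻¹ * (f x + So) - (X : ℝ)⁻¹ * (f X + Lo)|
              + |(h X : ℝ)⁻¹ * f x - (X : ℝ)⁻¹ * f X| := abs_sub _ _
        _ ≤ |(h X : ℝ)⁻¹ * (f x + So) - (X : ℝ)⁻¹ * (f X + Lo)|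
              + (|(h X : ℝ)⁻¹ * f x| + |(X : ℝ)⁻¹ * f X|) := by
            gcongr; exact abs_sub _ _
        _ ≤ _ := by gcongr
    linarith
  calc ‖((#{x ∈ Icc X (2 * X) | ε ≤ |(h X : ℝ)⁻¹ * ∑ n ∈ Ioc x (x + h X), f n
          - (X : ℝ)⁻¹ * ∑ n ∈ Ioc X (2 * X), f n|} : ℕ) : ℝ)‖
      = #{x ∈ Icc X (2 * X) | ε ≤ |(h X : ℝ)⁻¹ * ∑ n ∈ Ioc x (x + h X), f n
          - (X : ℝ)⁻¹ * ∑ n ∈ Ioc X (2 * X), f n|} := by simp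
    _ ≤ #{x ∈ Icc X (2 * X) | δ + C' * Real.log (Real.log (h X)) / Real.log (h X) <
            |(h X : ℝ)⁻¹ * ∑ n ∈ Icc x (x + h X), f n
              - (X : ℝ)⁻¹ * ∑ n ∈ Icc X (2 * X), f n|} := by exact_mod_cast hsub
    _ ≤ C * X * (Real.log (h X) ^ (1 / 3 : ℝ) / (δ ^ 2 * (h X : ℝ) ^ (δ / 25))
            + 1 / (δ ^ 2 * Real.log X ^ (1 / 50 : ℝ))) := hT1
    _ = X * g X := by simp only [hg_def]; ring
    _ ≤ X * c := by gcongr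
    _ = c * ‖((X : ℕ) : ℝ)‖ := by simp [mul_comm]

/-! ### Inputs from §3 and §7 of the paper -/

/-- `M(x, T) = min_{|t| ≤ T} 𝔻(f, n ↦ n^{it}; x)²`, the minimal squared pretentious distance of `f` from
the twists `n^{it}`, `|t| ≤ T` (Matomäki–Radziwiłł §3, `M(x, T₀)`; Mangerel 2018, `𝒟_f(x; T)`), as an
`iInf` over the subtype `t ∈ [-T, T]` of `Literature.pretentiousDistSq f (n ↦ n^{it}) x`
(`= ∑_{p ≤ x} (1 - Re (f(p) p^{-it}))/p`).  Junk value `0` for `T < 0` (empty index type); for `T ≥ 0`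
and `‖f‖ ≤ 1` the family is nonnegative, so the `iInf` is a genuine infimum (a minimum, by continuity in
`t`). [cite: MatomakiRadziwillAnnals2016, §3 (Lemma 1)] -/
noncomputable def minPretentiousDistSq (f : ℕ → ℂ) (x T : ℝ) : ℝ :=
  ⨅ t : Set.Icc (-T) T, pretentiousDistSq f (fun n => (n : ℂ) ^ (((t : ℝ) : ℂ) * Complex.I)) x

/-- `M(x, T) ≥ 0` for `1`-bounded `f` and `T ≥ 0`. [folklore] -/
theorem minPretentiousDistSq_nonneg {f : ℕ → ℂ} (hf : ∀ n, ‖f n‖ ≤ 1) (x : ℝ) {T : ℝ}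
    (hT : 0 ≤ T) : 0 ≤ minPretentiousDistSq f x T := by
  have : Nonempty (Set.Icc (-T) T) := ⟨⟨0, by simp [hT]⟩⟩
  refine le_ciInf fun t => pretentiousDistSq_nonneg hf (fun n => ?_) x
  rcases Nat.eq_zero_or_pos n with rfl | hn
  · rcases eq_or_ne ((((t : ℝ) : ℂ)) * Complex.I) 0 with h0 | h0
    · simp [h0]
    · simp [Complex.zero_cpow h0]
  · rw [Complex.norm_natCast_cpow_of_pos hn]
    simp

/-- NAMED FACT — **Halász's theorem, Halász–Montgomery–Tenenbaum form** (as printed in Mangerel 2018,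
Thm 1.1.5: "Let `x ≥ 3` and `T ≥ 1`. Uniformly over all `f ∈ ℳ`,
`M_f(x) ≪ x (1 + 𝒟_f(x; T)) e^{-𝒟_f(x; T)} + x/√T`", where `ℳ` is the class of multiplicative
`f : ℕ → ℂ` with `|f| ≤ 1`, `M_f(x) = ∑_{n ≤ x} f(n)` and `𝒟_f(x; T) = min_{|t| ≤ T} 𝔻(f, n^{it}; x)²`
= `minPretentiousDistSq f x T`; Mangerel cites Tenenbaum, Thm III.4.6, "building on Halász and
Montgomery", and notes Granville–Soundararajan's improvement `x/T`).  This is the theorem behind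
Matomäki–Radziwiłł's Lemma 1 (there printed, after partial summation to `F(σ + it)`, with the factor
`M e^{-M}` — a misprint for `(1 + M) e^{-M}`, as `f ≡ 1`, `M = 0` shows).
Users take `(h : halaszMontgomeryTenenbaum)`. [cite: Mangerel2018, Theorem 1.1.5] -/
def halaszMontgomeryTenenbaum : Prop :=
  ∃ C : ℝ, ∀ f : ArithmeticFunction ℂ, f.IsMultiplicative → (∀ n, ‖f n‖ ≤ 1) →
    ∀ x T : ℝ, 3 ≤ x → 1 ≤ T →
      ‖∑ n ∈ Icc 1 ⌊x⌋₊, f n‖ ≤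
        C * x * ((1 + minPretentiousDistSq f x T) * Real.exp (-minPretentiousDistSq f x T)
          + 1 / Real.sqrt T)

/-- NAMED FACT — **Lipschitz estimate for long averages** (Matomäki–Radziwiłł 2016, Lemma 4, "due to
Granville and Soundararajan": "Let `f : ℕ → [-1,1]` be a multiplicative function. For any
`x ∈ [X, 2X]` and `X/(log X)^{1/5} ≤ y ≤ X`, one has
`(1/y) ∑_{x ≤ n ≤ x+y} f(n) = (1/X) ∑_{X ≤ n ≤ 2X} f(n) + O((log X)^{-1/20})`."; the implied constant is
absolute and `X` is tacitly large, rendered `∃ C X₀`).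
Users take `(h : MatomakiRadziwill2016_lemma4)`. [cite: MatomakiRadziwillAnnals2016, Lemma 4] -/
def MatomakiRadziwill2016_lemma4 : Prop :=
  ∃ C X₀ : ℝ, ∀ f : ArithmeticFunction ℝ, f.IsMultiplicative → (∀ n, |f n| ≤ 1) →
    ∀ X x y : ℝ, X₀ ≤ X → X ≤ x → x ≤ 2 * X → X / Real.log X ^ (1 / 5 : ℝ) ≤ y → y ≤ X →
      |y⁻¹ * ∑ n ∈ Icc ⌈x⌉₊ ⌊x + y⌋₊, f n - X⁻¹ * ∑ n ∈ Icc ⌈X⌉₊ ⌊2 * X⌋₊, f n|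
        ≤ C / Real.log X ^ (1 / 20 : ℝ)

/-! ### Lemma 14 (the Parseval bound): the faithful real-sequence fact, and two deprecated renderings -/

/-- NAMED FACT — **Parseval bound** (Matomäki–Radziwiłł 2016, Lemma 14), for a **real** sequence —
the faithful rendering, PROVED downstream (`MatomakiRadziwill2016_lemma14_real_holds`,
`MatomakiRadziwillLemma14.lean`, with `C = 12 · 2431²`, `X₀ = e`).
As printed: "Let `|a_m| ≤ 1`. Assume `1 ≤ h₁ ≤ h₂ = X/(log X)^{1/5}`. Consider, for `X ≤ x ≤ 2X`,
`S_j(x) = ∑_{x ≤ m ≤ x+h_j} a_m` and write `A(s) := ∑_{X ≤ m ≤ 4X} a_m m^{-s}`. Then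
`(1/X) ∫_X^{2X} |S₁(x)/h₁ - S₂(x)/h₂|² dx ≪ (log X)^{-2/15} + ∫_{(log X)^{1/15}}^{X/h₁} |A(1+it)|² dt
 + max_{T ≥ X/h₁} (X/h₁)/T ∫_T^{2T} |A(1+it)|² dt`."; absolute implied constant, `X` tacitly large:
`∃ C X₀`; the `max` is an `iSup` over `T ∈ [X/h₁, ∞)` (a family bounded by `(X/h₁)(1 + log 4)²`).

**Why `a : ℕ → ℝ`.**  The paper applies the lemma (§9) only to `a_m = f(m) 1_𝒮(m)` with `f` real,
and its proof — Perron's formula, then a split of the line `Re s = 1` according to whether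
`|t| ≤ T₀ = (log X)^{1/15}` "or not", after which only the range `t ≥ T₀` is displayed — uses
`|A(1 - it)| = |A(1 + it)|`, which holds for real `a_m` (conjugate the sum).  For a complex sequence
the displayed, one-sided right-hand side sees only the frequencies `t ≥ T₀` of `A`, while the
left-hand side also feels `t ≤ -T₀`: e.g. for `a_m = g(m/X) m^{-i log X}` (`g` a fixed smooth bump on
`[1, 4]`) and `h₁ = X/(log X)²` the polynomial `A(1+it) = ∑ g(m/X) m^{-1-i(t + log X)}` is concentrated
near `t = -log X`, so that the right-hand side tends to `0` with `X`, whereas `|S₁(x)|/h₁ ≈ g(x/X)` and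
`S₂(x)/h₂ → 0` (the phase `m^{-i log X}` turns many times along `[x, x + h₂]`), so the left-hand
side does not.  Both complex-sequence renderings are formally REFUTED in tree along these lines:
`MatomakiRadziwill2016_lemma14_parseval_false` (`MatomakiRadziwillLemma14Refutation.lean`, sharp
twist `a_m = m^{-iM⁴}`) and `MatomakiRadziwill2016_lemma14_false`
(`MatomakiRadziwillLemma14SmoothRefutation.lean`, smoothly weighted twist).  Hence the earlier
renderings `MatomakiRadziwill2016_lemma14` and `MatomakiRadziwill2016_lemma14_parseval` (below,
`@[deprecated]` since the 2026-08-15 verdict clean-up), which quantify over `a : ℕ → ℂ`, over-state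
the lemma; this declaration is the faithful one and supersedes them.
Users take `(h : MatomakiRadziwill2016_lemma14_real)` and feed it
`MatomakiRadziwill2016_lemma14_real_holds`. [cite: MatomakiRadziwillAnnals2016, Lemma 14] -/
def MatomakiRadziwill2016_lemma14_real : Prop :=
  ∃ C X₀ : ℝ, ∀ a : ℕ → ℝ, (∀ m, |a m| ≤ 1) →
    ∀ X h₁ : ℝ, X₀ ≤ X → 1 ≤ h₁ → h₁ ≤ X / Real.log X ^ (1 / 5 : ℝ) →
      X⁻¹ * ∫ x in X..2 * X,
          (h₁⁻¹ * ∑ m ∈ Icc ⌈x⌉₊ ⌊x + h₁⌋₊, a m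
            - (X / Real.log X ^ (1 / 5 : ℝ))⁻¹ *
                ∑ m ∈ Icc ⌈x⌉₊ ⌊x + X / Real.log X ^ (1 / 5 : ℝ)⌋₊, a m) ^ 2 ≤
        C * (1 / Real.log X ^ (2 / 15 : ℝ)
          + (∫ t in Real.log X ^ (1 / 15 : ℝ)..X / h₁,
              ‖∑ m ∈ Icc ⌈X⌉₊ ⌊4 * X⌋₊, (a m : ℂ) * (m : ℂ) ^ (-(1 + (t : ℂ) * Complex.I))‖ ^ 2)
          + ⨆ T : Set.Ici (X / h₁), (X / h₁) / (T : ℝ) * ∫ t in (T : ℝ)..2 * T,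
              ‖∑ m ∈ Icc ⌈X⌉₊ ⌊4 * X⌋₊, (a m : ℂ) * (m : ℂ) ^ (-(1 + (t : ℂ) * Complex.I))‖ ^ 2)

/-- **DEPRECATED — mis-stated and REFUTED rendering** of the Parseval bound (Matomäki–Radziwiłł
2016, Lemma 14; verdict clean-up 2026-08-15).  Printed (arXiv:1501.04585 p. 15): "Let `|a_m| ≤ 1`.
Assume `1 ≤ h₁ ≤ h₂ = X/(log X)^{1/5}`. Consider, for `X ≤ x ≤ 2X`, `S_j(x) = ∑_{x ≤ m ≤ x+h_j} a_m`
and write `A(s) := ∑_{X ≤ m ≤ 4X} a_m m^{-s}`. Then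
`(1/X) ∫_X^{2X} |S₁(x)/h₁ - S₂(x)/h₂|² dx ≪ (log X)^{-2/15} + ∫_{(log X)^{1/15}}^{X/h₁} |A(1+it)|² dt
 + max_{T ≥ X/h₁} (X/h₁)/T ∫_T^{2T} |A(1+it)|² dt`."  (absolute implied constant, `X` tacitly large:
`∃ C X₀`; the `max` is an `iSup` over `T ∈ [X/h₁, ∞)` of a family bounded by `(X/h₁)(1 + log 4)²`).
**What is wrong with this rendering.** (i) It quantifies over COMPLEX sequences `a : ℕ → ℂ`,
whereas the printed lemma is stated, proved and used (§9, `a_m = f(m) 1_𝒮(m)`, `f` real) for a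
real sequence: the proof splits the Perron integral "according to whether `|t| ≤ T₀` or not" and
then displays only `∫_{1+iT₀}^{1+i∞}`, legitimate exactly when `|A(1 - it)| = |A(1 + it)|`; for
complex `a_m` the one-sided right-hand side (frequencies `t ≥ (log X)^{1/15}` only) does not
control the left-hand side.  (ii) The integral sign `∫ t in (log X)^{1/15}..X/h₁` is not
parenthesised and captures the final `⨆` term as part of its integrand (so the `max` term carries
the factor `X/h₁ - (log X)^{1/15}`).  **Refuted in tree:**
`MatomakiRadziwill2016_lemma14_false : ¬ MatomakiRadziwill2016_lemma14`
(`MatomakiRadziwillLemma14SmoothRefutation.lean`; counterexample `a_m = g(m/X) m^{-iL}` with a smooth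
plateau `g`, `X = e^{λ⁵}`, `L = 20λ`, `h₁ = X/(400λ)`).  **Corrected statement:**
`MatomakiRadziwill2016_lemma14_real` below (real `a_m`, correctly parenthesised), PROVED:
`MatomakiRadziwill2016_lemma14_real_holds` (`MatomakiRadziwillLemma14.lean`).  The statement is kept
verbatim (unchanged) only as the literal record and as the subject of its refutation; never take
`(h : MatomakiRadziwill2016_lemma14)` as a hypothesis (it is refutable, so anything follows) — every
use of the name now raises a deprecation warning pointing at the corrected fact.
[cite: MatomakiRadziwillAnnals2016, Lemma 14 (arXiv:1501.04585 p. 15) as mis-rendered for complex a_m — refuted in tree; corrected as MatomakiRadziwill2016_lemma14_real] -/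
@[deprecated MatomakiRadziwill2016_lemma14_real "mis-stated (complex `a_m`, mis-parenthesised right-hand side) and refuted by Literature.NumberTheory.Sieve.MatomakiRadziwill2016_lemma14_false (MatomakiRadziwillLemma14SmoothRefutation.lean): use Literature.NumberTheory.Sieve.MatomakiRadziwill2016_lemma14_real (proved: MatomakiRadziwill2016_lemma14_real_holds, MatomakiRadziwillLemma14.lean)" (since := "2026-08-15")]
def MatomakiRadziwill2016_lemma14 : Prop :=
  ∃ C X₀ : ℝ, ∀ a : ℕ → ℂ, (∀ m, ‖a m‖ ≤ 1) →
    ∀ X h₁ : ℝ, X₀ ≤ X → 1 ≤ h₁ → h₁ ≤ X / Real.log X ^ (1 / 5 : ℝ) →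
      X⁻¹ * ∫ x in X..2 * X,
          ‖(h₁ : ℂ)⁻¹ * ∑ m ∈ Icc ⌈x⌉₊ ⌊x + h₁⌋₊, a m
            - ((X / Real.log X ^ (1 / 5 : ℝ) : ℝ) : ℂ)⁻¹ *
                ∑ m ∈ Icc ⌈x⌉₊ ⌊x + X / Real.log X ^ (1 / 5 : ℝ)⌋₊, a m‖ ^ 2 ≤
        C * (1 / Real.log X ^ (2 / 15 : ℝ)
          + ∫ t in Real.log X ^ (1 / 15 : ℝ)..X / h₁,
              ‖∑ m ∈ Icc ⌈X⌉₊ ⌊4 * X⌋₊, a m * (m : ℂ) ^ (-(1 + (t : ℂ) * Complex.I))‖ ^ 2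
          + ⨆ T : Set.Ici (X / h₁), (X / h₁) / (T : ℝ) * ∫ t in (T : ℝ)..2 * T,
              ‖∑ m ∈ Icc ⌈X⌉₊ ⌊4 * X⌋₊, a m * (m : ℂ) ^ (-(1 + (t : ℂ) * Complex.I))‖ ^ 2)


/-- **DEPRECATED — REFUTED rendering** of the Parseval bound (Matomäki–Radziwiłł 2016, Lemma 14;
verdict clean-up 2026-08-15), the correctly parenthesised but still complex-sequence reading.
Printed (arXiv:1501.04585 p. 15): "Let `|a_m| ≤ 1`. Assume `1 ≤ h₁ ≤ h₂ = X/(log X)^{1/5}`.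
Consider, for `X ≤ x ≤ 2X`, `S_j(x) = ∑_{x ≤ m ≤ x+h_j} a_m` and write
`A(s) := ∑_{X ≤ m ≤ 4X} a_m m^{-s}`. Then
`(1/X) ∫_X^{2X} |S₁(x)/h₁ - S₂(x)/h₂|² dx ≪ (log X)^{-2/15} + ∫_{(log X)^{1/15}}^{X/h₁} |A(1+it)|² dt
 + max_{T ≥ X/h₁} (X/h₁)/T ∫_T^{2T} |A(1+it)|² dt`."  (absolute implied constant, `X` tacitly large:
`∃ C X₀`; the `max` is an `iSup` over `T ∈ [X/h₁, ∞)`, a family bounded by `(X/h₁)(1 + log 4)²`).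
**What is wrong with this rendering.** It quantifies over COMPLEX sequences `a : ℕ → ℂ`, whereas
the printed lemma is stated, proved and used (§9) for a real sequence — its proof splits the
Perron integral "according to whether `|t| ≤ T₀` or not" and then displays only
`∫_{1+iT₀}^{1+i∞}`, which uses `|A(1 - it)| = |A(1 + it)|`, i.e. real `a_m`; for complex `a_m` the
one-sided right-hand side (frequencies `t ≥ (log X)^{1/15}` only) does not control the left-hand
side, which also feels `t ≤ -(log X)^{1/15}`.  **Refuted in tree (negation proved):**
`MatomakiRadziwill2016_lemma14_parseval_false : ¬ MatomakiRadziwill2016_lemma14_parseval`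
(`MatomakiRadziwillLemma14Refutation.lean`; counterexample `X = exp(M¹⁵)`, `a_m = m^{-iM⁴}`,
`h₁ = X/M⁵`: the right-hand side is `≤ 22C/M` while the left-hand side is `≥ 1/4`); a second,
independent refutation is `MatomakiRadziwill2016_lemma14_false` through
`MatomakiRadziwill2016_lemma14_of_parseval`.  **Corrected statement:**
`MatomakiRadziwill2016_lemma14_real` below (real `a_m`), PROVED:
`MatomakiRadziwill2016_lemma14_real_holds` (`MatomakiRadziwillLemma14.lean`).  The statement is kept
verbatim (unchanged) only as the literal record and as the subject of its refutation; never take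
`(h : MatomakiRadziwill2016_lemma14_parseval)` as a hypothesis (anything follows) — every use of the
name now raises a deprecation warning pointing at the corrected fact.
[cite: MatomakiRadziwillAnnals2016, Lemma 14 (arXiv:1501.04585 p. 15) as mis-rendered for complex a_m — refuted in tree (MatomakiRadziwill2016_lemma14_parseval_false); corrected as MatomakiRadziwill2016_lemma14_real] -/
@[deprecated MatomakiRadziwill2016_lemma14_real "refuted by Literature.NumberTheory.Sieve.MatomakiRadziwill2016_lemma14_parseval_false (MatomakiRadziwillLemma14Refutation.lean; the printed lemma is for real a_m): use Literature.NumberTheory.Sieve.MatomakiRadziwill2016_lemma14_real (proved: MatomakiRadziwill2016_lemma14_real_holds, MatomakiRadziwillLemma14.lean)" (since := "2026-08-15")]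
def MatomakiRadziwill2016_lemma14_parseval : Prop :=
  ∃ C X₀ : ℝ, ∀ a : ℕ → ℂ, (∀ m, ‖a m‖ ≤ 1) →
    ∀ X h₁ : ℝ, X₀ ≤ X → 1 ≤ h₁ → h₁ ≤ X / Real.log X ^ (1 / 5 : ℝ) →
      X⁻¹ * ∫ x in X..2 * X,
          ‖(h₁ : ℂ)⁻¹ * ∑ m ∈ Icc ⌈x⌉₊ ⌊x + h₁⌋₊, a m
            - ((X / Real.log X ^ (1 / 5 : ℝ) : ℝ) : ℂ)⁻¹ *
                ∑ m ∈ Icc ⌈x⌉₊ ⌊x + X / Real.log X ^ (1 / 5 : ℝ)⌋₊, a m‖ ^ 2 ≤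
        C * (1 / Real.log X ^ (2 / 15 : ℝ)
          + (∫ t in Real.log X ^ (1 / 15 : ℝ)..X / h₁,
              ‖∑ m ∈ Icc ⌈X⌉₊ ⌊4 * X⌋₊, a m * (m : ℂ) ^ (-(1 + (t : ℂ) * Complex.I))‖ ^ 2)
          + ⨆ T : Set.Ici (X / h₁), (X / h₁) / (T : ℝ) * ∫ t in (T : ℝ)..2 * T,
              ‖∑ m ∈ Icc ⌈X⌉₊ ⌊4 * X⌋₊, a m * (m : ℂ) ^ (-(1 + (t : ℂ) * Complex.I))‖ ^ 2)

/-- **Deprecated (vacuous: its hypothesis `MatomakiRadziwill2016_lemma14_parseval` is refuted,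
`MatomakiRadziwill2016_lemma14_parseval_false`).**  The mis-parenthesised rendering
`MatomakiRadziwill2016_lemma14` is a consequence of the correctly parenthesised one: for
`X ≥ exp(2^15)` one has `X/h₁ - (log X)^{1/15} ≥ (log X)^{1/5} - (log X)^{1/15} ≥ 1`, and the `max`
term is nonnegative.  Kept as the record through which `MatomakiRadziwill2016_lemma14_false` is a
second refutation of the parseval rendering. [cite: MatomakiRadziwillAnnals2016, Lemma 14] -/
@[deprecated "vacuous: the hypothesis MatomakiRadziwill2016_lemma14_parseval is refuted (MatomakiRadziwill2016_lemma14_parseval_false) and so is the conclusion (MatomakiRadziwill2016_lemma14_false); the faithful Lemma 14 is MatomakiRadziwill2016_lemma14_real, proved (MatomakiRadziwill2016_lemma14_real_holds)" (since := "2026-08-15")]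
theorem MatomakiRadziwill2016_lemma14_of_parseval (h : MatomakiRadziwill2016_lemma14_parseval) :
    MatomakiRadziwill2016_lemma14 := by
  obtain ⟨C, X₀, H⟩ := h
  refine ⟨|C|, max X₀ (Real.exp (2 ^ 15)), ?_⟩
  intro a ha X h₁ hX hh₁ hh₂
  have hX₀ : X₀ ≤ X := (le_max_left _ _).trans hX
  have hXe : Real.exp (2 ^ 15) ≤ X := (le_max_right _ _).trans hX
  have hX0 : 0 < X := (Real.exp_pos _).trans_le hXe
  have hℓ : (2 : ℝ) ^ 15 ≤ Real.log X := by
    rw [← Real.log_exp (2 ^ 15)]; exact Real.log_le_log (Real.exp_pos _) hXe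
  have hℓ1 : 1 ≤ Real.log X := le_trans (by norm_num) hℓ
  have hℓ0 : 0 < Real.log X := by linarith
  set T₀ := Real.log X ^ (1 / 15 : ℝ) with hT₀
  set A : ℝ → ℝ := fun t =>
    ‖∑ m ∈ Icc ⌈X⌉₊ ⌊4 * X⌋₊, a m * (m : ℂ) ^ (-(1 + (t : ℂ) * Complex.I))‖ ^ 2 with hA
  -- the `max` term is a nonnegative real number
  set S := ⨆ T : Set.Ici (X / h₁), (X / h₁) / (T : ℝ) * ∫ t in (T : ℝ)..2 * T, A t with hS
  have hh₁0 : 0 < h₁ := by linarith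
  have hXh : 0 < X / h₁ := div_pos hX0 hh₁0
  have hAnn : ∀ t, 0 ≤ A t := fun t => sq_nonneg _
  have hS0 : 0 ≤ S := by
    refine Real.iSup_nonneg fun T => ?_
    have hT0 : 0 < (T : ℝ) := hXh.trans_le T.2
    exact mul_nonneg (by positivity) (intervalIntegral.integral_nonneg (by linarith) fun t _ => hAnn t)
  -- `X/h₁ - T₀ ≥ 1`
  have hT₀2 : 2 ≤ T₀ := by
    have : (2 : ℝ) = ((2 : ℝ) ^ 15) ^ (1 / 15 : ℝ) := by
      rw [← Real.rpow_natCast, ← Real.rpow_mul (by norm_num)]; norm_num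
    rw [hT₀, this]
    exact Real.rpow_le_rpow (by norm_num) hℓ (by norm_num)
  have hT₀cube : T₀ ^ 3 = Real.log X ^ (1 / 5 : ℝ) := by
    rw [hT₀, ← Real.rpow_natCast, ← Real.rpow_mul hℓ0.le]; norm_num
  have hgap : 1 ≤ X / h₁ - T₀ := by
    have h1 : Real.log X ^ (1 / 5 : ℝ) ≤ X / h₁ := by
      rw [le_div_iff₀ hh₁0]
      have := mul_le_mul_of_nonneg_right hh₂ (Real.rpow_nonneg hℓ0.le (1 / 5 : ℝ))
      rwa [div_mul_cancel₀ _ (Real.rpow_pos_of_pos hℓ0 _).ne', mul_comm] at this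
    have hT0 : 0 ≤ T₀ := by linarith
    have h4 : 4 ≤ T₀ ^ 2 := by nlinarith
    have h2 : 4 * T₀ ≤ T₀ ^ 3 :=
      calc 4 * T₀ ≤ T₀ ^ 2 * T₀ := mul_le_mul_of_nonneg_right h4 hT0
        _ = T₀ ^ 3 := by ring
    linarith
  -- continuity of `A`
  have hAcont : Continuous A := by
    refine ((continuous_finsetSum _ fun n _ => ?_).norm).pow 2
    refine continuous_const.mul (Continuous.const_cpow (by fun_prop) (Or.inr fun t h0 => ?_))
    have := congrArg Complex.re h0
    simp at this
  -- split the mis-parenthesised integral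
  have hsplit : ∫ t in T₀..X / h₁, (A t + S) = (∫ t in T₀..X / h₁, A t) + (X / h₁ - T₀) * S := by
    rw [intervalIntegral.integral_add (hAcont.intervalIntegrable _ _) intervalIntegrable_const,
      intervalIntegral.integral_const, smul_eq_mul]
  have hI0 : 0 ≤ ∫ t in T₀..X / h₁, A t :=
    intervalIntegral.integral_nonneg (by linarith) fun t _ => hAnn t
  have hmain := H a ha X h₁ hX₀ hh₁ hh₂
  refine hmain.trans ?_
  change C * (1 / Real.log X ^ (2 / 15 : ℝ) + (∫ t in T₀..X / h₁, A t) + S)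
    ≤ |C| * (1 / Real.log X ^ (2 / 15 : ℝ) + ∫ t in T₀..X / h₁, (A t + S))
  rw [hsplit]
  have hpos : 0 ≤ 1 / Real.log X ^ (2 / 15 : ℝ) + (∫ t in T₀..X / h₁, A t) + S := by positivity
  calc C * (1 / Real.log X ^ (2 / 15 : ℝ) + (∫ t in T₀..X / h₁, A t) + S)
      ≤ |C| * (1 / Real.log X ^ (2 / 15 : ℝ) + (∫ t in T₀..X / h₁, A t) + S) :=
        mul_le_mul_of_nonneg_right (le_abs_self C) hpos
    _ ≤ |C| * (1 / Real.log X ^ (2 / 15 : ℝ) + ((∫ t in T₀..X / h₁, A t) + (X / h₁ - T₀) * S)) := by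
        apply mul_le_mul_of_nonneg_left _ (abs_nonneg C)
        nlinarith
    _ = _ := by ring

/-- **Deprecated (vacuous: its hypothesis `MatomakiRadziwill2016_lemma14_parseval` is refuted,
`MatomakiRadziwill2016_lemma14_parseval_false`; the conclusion is proved outright,
`MatomakiRadziwill2016_lemma14_real_holds`).**  The complex-sequence rendering
`MatomakiRadziwill2016_lemma14_parseval` implies the faithful real-sequence rendering
`MatomakiRadziwill2016_lemma14_real` (specialise to `m ↦ (a m : ℂ)`; the left-hand sides agree
because `‖(r : ℂ)‖² = r²`). [cite: MatomakiRadziwillAnnals2016, Lemma 14] -/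
@[deprecated "vacuous: the hypothesis MatomakiRadziwill2016_lemma14_parseval is refuted (MatomakiRadziwill2016_lemma14_parseval_false); use MatomakiRadziwill2016_lemma14_real_holds (MatomakiRadziwillLemma14.lean) for the conclusion" (since := "2026-08-15")]
theorem MatomakiRadziwill2016_lemma14_real_of_parseval
    (h : MatomakiRadziwill2016_lemma14_parseval) : MatomakiRadziwill2016_lemma14_real := by
  obtain ⟨C, X₀, H⟩ := h
  refine ⟨C, X₀, fun a ha X h₁ hX hh₁ hh₂ => ?_⟩
  have key := H (fun m => (a m : ℂ)) (fun m => by simpa using ha m) X h₁ hX hh₁ hh₂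
  convert key using 4 with x
  have hc : ((h₁⁻¹ * ∑ m ∈ Icc ⌈x⌉₊ ⌊x + h₁⌋₊, a m
      - (X / Real.log X ^ (1 / 5 : ℝ))⁻¹ *
          ∑ m ∈ Icc ⌈x⌉₊ ⌊x + X / Real.log X ^ (1 / 5 : ℝ)⌋₊, a m : ℝ) : ℂ)
      = (h₁ : ℂ)⁻¹ * ∑ m ∈ Icc ⌈x⌉₊ ⌊x + h₁⌋₊, (a m : ℂ)
        - ((X / Real.log X ^ (1 / 5 : ℝ) : ℝ) : ℂ)⁻¹ *
            ∑ m ∈ Icc ⌈x⌉₊ ⌊x + X / Real.log X ^ (1 / 5 : ℝ)⌋₊, (a m : ℂ) := by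
    push_cast; rfl
  rw [← hc, Complex.norm_real, Real.norm_eq_abs, sq_abs]

/-! ### The interval systems `[P_j, Q_j]` and the sets `𝒮`, `𝒮_𝒥` of §2 -/

/-- An **interval system** as in §2 of Matomäki–Radziwiłł, at level `X ≥ 1` with parameter `η`:
"Consider a sequence of increasing intervals `[P_j, Q_j]` such that `Q_1 ≤ exp(√log X)`; the
intervals are not too far from each other, precisely `log log Q_j / (log P_{j-1} - 1) ≤ η/(4j²)` (2);
the intervals are not too close to each other, precisely `(η/j²) log P_j ≥ 8 log Q_{j-1} + 16 log j`
(3)", together with "`J`, the largest index `j` such that `Q_j ≤ exp((log X)^{1/2})`" (used to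
define `𝒮`).  Rendering: `P Q : ℕ → ℝ` indexed from `j = 1` (index `0` is unused); (2), (3) for
`j ≥ 2`; all `P_j > 0` (`pos_P`: the intervals are intervals of positive reals, so that `Real.log`
is the genuine logarithm in (2), (3)), `1 ≤ P_1` (in the theorems `[P_1, Q_1] ⊂ [1, h]`) and
`P_j ≤ Q_j`.  Condition (2) is printed as a quotient with the positive denominator `log P_{j-1} - 1`
(the paper takes `P_1 ≥ (log Q_1)^{40/η}` large) and is recorded with the denominator cleared, which
is the intended reading (for `P_{j-1} ≤ e` the literal quotient would be `≤ 0 ≤ η/(4j²)` vacuously).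
Given `pos_P` and `Q_1 ≥ P_1 ≥ 1`, condition (3) forces `log P_j > (8 j²/η) log Q_{j-1} ≥ log Q_{j-1}`,
i.e. `Q_j ≥ P_j > Q_{j-1} > 0`: the intervals increase strictly (`SieveIntervalSystem.Q_lt_P_succ`,
proved below), so "`J` is the largest index with `Q_J ≤ exp(√log X)`" is the pair of fields `Q_J_le`,
`lt_Q_succ`, and `Q_1 ≤ exp(√log X)` follows (`SieveIntervalSystem.Q_one_le`); in particular the
sequence is infinite, as the proof of Proposition 1 (§8.3, `Q_{J+1} > exp(√log X)`) requires.  The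
intended model is the paper's example (4): any `[P_1, Q_1]` with
`exp(√log X) ≥ Q_1 ≥ P_1 ≥ (log Q_1)^{40/η}` large and `P_j = exp(j^{4j} (log Q_1)^{j-1} log P_1)`,
`Q_j = exp(j^{4j+2} (log Q_1)^j)` for `j ≥ 2` (its formal construction is left to the file assembling
Theorem 1 from Theorem 3, §9).
[cite: MatomakiRadziwillAnnals2016, §2 (conditions (2), (3), example (4))] -/
structure SieveIntervalSystem (η X : ℝ) where
  /-- left endpoints `P_j`, `j ≥ 1` -/
  P : ℕ → ℝ
  /-- right endpoints `Q_j`, `j ≥ 1` -/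
  Q : ℕ → ℝ
  /-- the number `J ≥ 1` of intervals used to define `𝒮 = 𝒮_X` -/
  J : ℕ
  /-- the endpoints are positive reals -/
  pos_P : ∀ j, 1 ≤ j → 0 < P j
  one_le_P_one : 1 ≤ P 1
  P_le_Q : ∀ j, 1 ≤ j → P j ≤ Q j
  /-- (2), denominator cleared: `log log Q_j ≤ (η / (4 j²)) (log P_{j-1} - 1)` for `j ≥ 2` -/
  notTooFar : ∀ j, 2 ≤ j → Real.log (Real.log (Q j)) ≤ η / (4 * (j : ℝ) ^ 2) * (Real.log (P (j - 1)) - 1)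
  /-- (3): `(η / j²) log P_j ≥ 8 log Q_{j-1} + 16 log j` for `j ≥ 2` -/
  notTooClose : ∀ j, 2 ≤ j → 8 * Real.log (Q (j - 1)) + 16 * Real.log j ≤ η / (j : ℝ) ^ 2 * Real.log (P j)
  one_le_J : 1 ≤ J
  Q_J_le : Q J ≤ Real.exp (Real.sqrt (Real.log X))
  lt_Q_succ : Real.exp (Real.sqrt (Real.log X)) < Q (J + 1)

namespace SieveIntervalSystem

variable {η X : ℝ} (I : SieveIntervalSystem η X)

/-- The right endpoints are positive. [folklore] -/
theorem pos_Q {j : ℕ} (hj : 1 ≤ j) : 0 < I.Q j :=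
  (I.pos_P j hj).trans_le (I.P_le_Q j hj)

/-- One step of "the intervals increase": if `Q_j ≥ 1` then (3) at `j + 1` gives `Q_j < P_{j+1}`
(for `0 < η ≤ 8`, in particular for the paper's `η ∈ (0, 1/6)`). [folklore] -/
theorem Q_lt_P_succ_of_one_le (hη : 0 < η) (hη' : η ≤ 8) {j : ℕ} (hj : 1 ≤ j)
    (h1 : 1 ≤ I.Q j) : I.Q j < I.P (j + 1) := by
  have h3 := I.notTooClose (j + 1) (by omega)
  simp only [Nat.add_sub_cancel] at h3
  have hQ : 0 ≤ Real.log (I.Q j) := Real.log_nonneg h1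
  have hj2 : (2 : ℝ) ≤ ((j + 1 : ℕ) : ℝ) := by exact_mod_cast (by omega : 2 ≤ j + 1)
  have hlogj : 0 < Real.log ((j + 1 : ℕ) : ℝ) := Real.log_pos (by linarith)
  have hP : 0 < I.P (j + 1) := I.pos_P _ (by omega)
  have hsq : (4 : ℝ) ≤ ((j + 1 : ℕ) : ℝ) ^ 2 := by nlinarith
  have hcoef : η / ((j + 1 : ℕ) : ℝ) ^ 2 ≤ 8 := by
    rw [div_le_iff₀ (by positivity)]
    nlinarith
  have hcoefpos : 0 < η / ((j + 1 : ℕ) : ℝ) ^ 2 := by positivity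
  have hprodpos : 0 < η / ((j + 1 : ℕ) : ℝ) ^ 2 * Real.log (I.P (j + 1)) := by linarith
  have hlogP : 0 < Real.log (I.P (j + 1)) := pos_of_mul_pos_right hprodpos hcoefpos.le
  have h8 : 8 * Real.log (I.Q j) < 8 * Real.log (I.P (j + 1)) :=
    calc 8 * Real.log (I.Q j) < η / ((j + 1 : ℕ) : ℝ) ^ 2 * Real.log (I.P (j + 1)) := by linarith
      _ ≤ 8 * Real.log (I.P (j + 1)) := mul_le_mul_of_nonneg_right hcoef hlogP.le
  exact (Real.log_lt_log_iff (by linarith) hP).mp (by linarith)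

/-- `Q_j ≥ 1` and `Q_j < P_{j+1}` for all `j ≥ 1` (induction on `j` from `Q_1 ≥ P_1 ≥ 1`, using (3)).
[folklore] -/
theorem one_le_Q_and_Q_lt_P_succ (hη : 0 < η) (hη' : η ≤ 8) {j : ℕ} (hj : 1 ≤ j) :
    1 ≤ I.Q j ∧ I.Q j < I.P (j + 1) := by
  induction j, hj using Nat.le_induction with
  | base =>
    have h1 : 1 ≤ I.Q 1 := I.one_le_P_one.trans (I.P_le_Q 1 le_rfl)
    exact ⟨h1, I.Q_lt_P_succ_of_one_le hη hη' le_rfl h1⟩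
  | succ j hj ih =>
    have h1 : 1 ≤ I.Q (j + 1) := (ih.1.trans ih.2.le).trans (I.P_le_Q (j + 1) (by omega))
    exact ⟨h1, I.Q_lt_P_succ_of_one_le hη hη' (by omega) h1⟩

/-- **The intervals increase strictly**: `Q_j < P_{j+1} (≤ Q_{j+1})` for `j ≥ 1` — the printed
"sequence of increasing intervals", a consequence of positivity, `P_1 ≥ 1` and (3).
[cite: MatomakiRadziwillAnnals2016, §2] -/
theorem Q_lt_P_succ (hη : 0 < η) (hη' : η ≤ 8) {j : ℕ} (hj : 1 ≤ j) : I.Q j < I.P (j + 1) :=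
  (I.one_le_Q_and_Q_lt_P_succ hη hη' hj).2

/-- `1 ≤ Q_j` for `j ≥ 1`. [folklore] -/
theorem one_le_Q (hη : 0 < η) (hη' : η ≤ 8) {j : ℕ} (hj : 1 ≤ j) : 1 ≤ I.Q j :=
  (I.one_le_Q_and_Q_lt_P_succ hη hη' hj).1

/-- `Q_i < Q_j` for `1 ≤ i < j`. [folklore] -/
theorem Q_lt_Q (hη : 0 < η) (hη' : η ≤ 8) {i j : ℕ} (hi : 1 ≤ i) (hij : i < j) : I.Q i < I.Q j := by
  induction j, hij using Nat.le_induction with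
  | base => exact (I.Q_lt_P_succ hη hη' hi).trans_le (I.P_le_Q _ (by omega))
  | succ j hj ih => exact ih.trans ((I.Q_lt_P_succ hη hη' (by omega)).trans_le (I.P_le_Q _ (by omega)))

/-- `Q_1 ≤ exp(√log X)` (the first bullet of §2), from `Q_1 ≤ Q_J ≤ exp(√log X)`.
[cite: MatomakiRadziwillAnnals2016, §2] -/
theorem Q_one_le (hη : 0 < η) (hη' : η ≤ 8) : I.Q 1 ≤ Real.exp (Real.sqrt (Real.log X)) := by
  rcases eq_or_lt_of_le I.one_le_J with h | h
  · simpa [← h] using I.Q_J_le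
  · exact (I.Q_lt_Q hη hη' le_rfl h).le.trans I.Q_J_le

/-- `J` is the **largest** index with `Q_J ≤ exp(√log X)`. [cite: MatomakiRadziwillAnnals2016, §2] -/
theorem le_J_of_Q_le (hη : 0 < η) (hη' : η ≤ 8) {j : ℕ}
    (h : I.Q j ≤ Real.exp (Real.sqrt (Real.log X))) : j ≤ I.J := by
  by_contra hlt
  push Not at hlt
  have h1 : I.Q (I.J + 1) ≤ I.Q j := by
    rcases eq_or_lt_of_le (Nat.succ_le_of_lt hlt) with h' | h'
    · rw [← h']
    · exact (I.Q_lt_Q hη hη' (by omega) h').le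
  linarith [I.lt_Q_succ]

/-- `n` **avoids** the intervals indexed by `𝒥`: no prime factor of `n` lies in
`⋃_{j ∈ 𝒥} [P_j, Q_j]` (the support condition of the completely multiplicative `g_𝒥` of Lemma 5).
[cite: MatomakiRadziwillAnnals2016, Lemma 5] -/
def Avoids (𝒥 : Finset ℕ) (n : ℕ) : Prop :=
  ∀ j ∈ 𝒥, ∀ p ∈ n.primeFactors, (p : ℝ) < I.P j ∨ I.Q j < (p : ℝ)

/-- `n ∈ 𝒮`: "`n` has at least one prime factor in each of the intervals `[P_j, Q_j]` for `j ≤ J`"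
(§2; the paper's `𝒮 = 𝒮_X` is the set of such `n` in the range `X ≤ n ≤ 2X` at hand, and the range is
always displayed separately in the sums, so `𝒮` is recorded as this predicate on `ℕ`).
[cite: MatomakiRadziwillAnnals2016, §2] -/
def Mem (n : ℕ) : Prop :=
  ∀ j ∈ Icc 1 I.J, ∃ p ∈ n.primeFactors, I.P j ≤ (p : ℝ) ∧ (p : ℝ) ≤ I.Q j

/-- `Avoids 𝒥` is decidable (classically, through `Real.decidableLT`), so that it can be used in
`Finset.filter`. [folklore] -/
noncomputable instance (𝒥 : Finset ℕ) : DecidablePred (I.Avoids 𝒥) := fun n => by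
  unfold Avoids; infer_instance

/-- `Mem` is decidable (classically), so that `∑_{n ∈ s, n ∈ 𝒮}` is `∑ n ∈ s.filter I.Mem`. [folklore] -/
noncomputable instance : DecidablePred I.Mem := fun n => by
  unfold Mem; infer_instance

/-- The completely multiplicative function `g_𝒥` of Lemma 5: `g_𝒥(p^k) = 1` if
`p ∉ ⋃_{j∈𝒥} [P_j, Q_j]` and `0` otherwise, i.e. `g_𝒥(n) = 1` if `n ≥ 1` avoids the intervals indexed
by `𝒥` and `g_𝒥(n) = 0` otherwise (`g_𝒥(0) = 0`, an `ArithmeticFunction`).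
[cite: MatomakiRadziwillAnnals2016, Lemma 5] -/
noncomputable def g (𝒥 : Finset ℕ) : ArithmeticFunction ℝ where
  toFun n := if n = 0 then 0 else if I.Avoids 𝒥 n then 1 else 0
  map_zero' := by simp

/-- Unfolding `g_𝒥`. [folklore] -/
theorem g_apply (𝒥 : Finset ℕ) (n : ℕ) :
    I.g 𝒥 n = if n = 0 then 0 else if I.Avoids 𝒥 n then 1 else 0 := rfl

/-- Unfolding `g_𝒥` at `n ≠ 0`. [folklore] -/
theorem g_apply_of_ne_zero (𝒥 : Finset ℕ) {n : ℕ} (hn : n ≠ 0) :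
    I.g 𝒥 n = if I.Avoids 𝒥 n then 1 else 0 := by
  rw [g_apply, if_neg hn]

/-- `|g_𝒥(n)| ≤ 1`. [folklore] -/
theorem abs_g_le_one (𝒥 : Finset ℕ) (n : ℕ) : |I.g 𝒥 n| ≤ 1 := by
  rw [g_apply]
  split_ifs <;> simp

/-- `mn` avoids the intervals iff `m` and `n` do (`m, n ≠ 0`; the prime factors of `mn` are those of
`m` and of `n`). [folklore] -/
theorem avoids_mul_iff (𝒥 : Finset ℕ) {m n : ℕ} (hm : m ≠ 0) (hn : n ≠ 0) :
    I.Avoids 𝒥 (m * n) ↔ I.Avoids 𝒥 m ∧ I.Avoids 𝒥 n := by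
  simp only [Avoids, Nat.primeFactors_mul hm hn, Finset.mem_union]
  constructor
  · intro h
    exact ⟨fun j hj p hp => h j hj p (Or.inl hp), fun j hj p hp => h j hj p (Or.inr hp)⟩
  · rintro ⟨h1, h2⟩ j hj p (hp | hp)
    exacts [h1 j hj p hp, h2 j hj p hp]

/-- `g_𝒥` is multiplicative (indeed completely multiplicative). [cite: MatomakiRadziwillAnnals2016, Lemma 5] -/
theorem isMultiplicative_g (𝒥 : Finset ℕ) : (I.g 𝒥).IsMultiplicative := by
  refine ⟨?_, ?_⟩
  · rw [g_apply_of_ne_zero _ _ one_ne_zero, if_pos]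
    intro j _ p hp
    simp at hp
  · intro m n _
    rcases eq_or_ne m 0 with rfl | hm
    · simp [g_apply]
    rcases eq_or_ne n 0 with rfl | hn
    · simp [g_apply]
    rw [g_apply_of_ne_zero _ _ (mul_ne_zero hm hn), g_apply_of_ne_zero _ _ hm,
      g_apply_of_ne_zero _ _ hn]
    by_cases h1 : I.Avoids 𝒥 m <;> by_cases h2 : I.Avoids 𝒥 n <;>
      simp [h1, h2, I.avoids_mul_iff 𝒥 hm hn]

/-- `n ∈ 𝒮` iff `n` avoids none of the single intervals `[P_j, Q_j]`, `1 ≤ j ≤ J`. [folklore] -/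
theorem mem_iff_forall_not_avoids (n : ℕ) :
    I.Mem n ↔ ∀ j ∈ Icc 1 I.J, ¬ I.Avoids {j} n := by
  simp only [Mem, Avoids, Finset.mem_singleton, forall_eq, not_forall, not_or, not_lt,
    exists_prop]

/-- `n` avoids the intervals indexed by `𝒥` iff it avoids each of them. [folklore] -/
theorem avoids_iff_forall (𝒥 : Finset ℕ) (n : ℕ) :
    I.Avoids 𝒥 n ↔ ∀ j ∈ 𝒥, I.Avoids {j} n := by
  simp [Avoids]

/-- **Matomäki–Radziwiłł 2016, Lemma 5** (PROVED; inclusion–exclusion): "Let `𝒮` be as in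
Section 2. For `𝒥 ⊆ {1, …, J}` let `g_𝒥` be the completely multiplicative function with
`g_𝒥(p^j) = 1` if `p ∉ ⋃_{j ∈ 𝒥} [P_j, Q_j]` and `0` otherwise. Then
`∑_{X ≤ n ≤ 2X, n ∈ 𝒮} a_n = ∑_{X ≤ n ≤ 2X} a_n ∏_{j=1}^{J} (1 - g_{{j}}(n))
 = ∑_{𝒥 ⊆ {1,…,J}} (-1)^{#𝒥} ∑_{X ≤ n ≤ 2X} g_𝒥(n) a_n`."  Stated over an arbitrary finite range
`s ⊂ ℕ` (the paper's `X ≤ n ≤ 2X`; at `n = 0` both sides vanish) and coefficients in a real vector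
space.
[cite: MatomakiRadziwillAnnals2016, Lemma 5] -/
theorem sum_filter_mem_eq {M : Type*} [AddCommGroup M] [Module ℝ M] (s : Finset ℕ) (a : ℕ → M) :
    ∑ n ∈ s.filter I.Mem, a n =
      ∑ 𝒥 ∈ (Icc 1 I.J).powerset, ((-1 : ℝ) ^ #𝒥) • ∑ n ∈ s, I.g 𝒥 n • a n := by
  classical
  -- `1_𝒮(n) = ∏_j (1 - g_{j}(n)) = ∑_𝒥 (-1)^{#𝒥} g_𝒥(n)` (for `n = 0` both sides vanish:
  -- `0 ∉ 𝒮` as `J ≥ 1` and `0` has no prime factors, and `g_𝒥(0) = 0`)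
  have key : ∀ n, (if I.Mem n then (1 : ℝ) else 0) =
      ∑ 𝒥 ∈ (Icc 1 I.J).powerset, (-1 : ℝ) ^ #𝒥 * I.g 𝒥 n := by
    intro n
    rcases eq_or_ne n 0 with rfl | hn0
    · have hM : ¬ I.Mem 0 := fun h => by
        obtain ⟨p, hp, _⟩ := h 1 (Finset.mem_Icc.mpr ⟨le_rfl, I.one_le_J⟩)
        simp at hp
      rw [if_neg hM]
      symm
      exact Finset.sum_eq_zero fun 𝒥 _ => by simp
    have h1 : (if I.Mem n then (1 : ℝ) else 0) = ∏ j ∈ Icc 1 I.J, (1 - I.g {j} n) := by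
      by_cases hM : I.Mem n
      · rw [if_pos hM]
        symm
        refine Finset.prod_eq_one fun j hj => ?_
        rw [g_apply_of_ne_zero _ _ hn0, if_neg ((I.mem_iff_forall_not_avoids n).mp hM j hj)]
        simp
      · rw [if_neg hM]
        rw [mem_iff_forall_not_avoids] at hM
        push Not at hM
        obtain ⟨j, hj, hj'⟩ := hM
        symm
        exact Finset.prod_eq_zero hj (by rw [g_apply_of_ne_zero _ _ hn0, if_pos hj']; simp)
    rw [h1]
    have h2 : ∏ j ∈ Icc 1 I.J, (1 - I.g {j} n) = ∏ j ∈ Icc 1 I.J, (-I.g {j} n + 1) :=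
      Finset.prod_congr rfl fun j _ => by ring
    rw [h2, Finset.prod_add]
    refine Finset.sum_congr rfl fun 𝒥 h𝒥 => ?_
    rw [Finset.prod_const_one, mul_one]
    have h3 : ∏ j ∈ 𝒥, -I.g {j} n = (-1) ^ #𝒥 * ∏ j ∈ 𝒥, I.g {j} n := by
      rw [Finset.prod_neg]
    rw [h3]
    congr 1
    -- `∏_{j∈𝒥} g_{j}(n) = g_𝒥(n)`
    simp only [g_apply_of_ne_zero _ _ hn0]
    by_cases hA : I.Avoids 𝒥 n
    · rw [if_pos hA]
      refine Finset.prod_eq_one fun j hj => ?_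
      rw [if_pos ((I.avoids_iff_forall 𝒥 n).mp hA j hj)]
    · rw [if_neg hA]
      rw [avoids_iff_forall] at hA
      push Not at hA
      obtain ⟨j, hj, hj'⟩ := hA
      exact Finset.prod_eq_zero hj (if_neg hj')
  calc ∑ n ∈ s.filter I.Mem, a n = ∑ n ∈ s, (if I.Mem n then (1 : ℝ) else 0) • a n := by
        rw [Finset.sum_filter]
        refine Finset.sum_congr rfl fun n _ => ?_
        split_ifs <;> simp
    _ = ∑ n ∈ s, (∑ 𝒥 ∈ (Icc 1 I.J).powerset, (-1 : ℝ) ^ #𝒥 * I.g 𝒥 n) • a n :=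
        Finset.sum_congr rfl fun n _ => by rw [key n]
    _ = ∑ n ∈ s, ∑ 𝒥 ∈ (Icc 1 I.J).powerset, ((-1 : ℝ) ^ #𝒥 * I.g 𝒥 n) • a n :=
        Finset.sum_congr rfl fun n _ => Finset.sum_smul
    _ = ∑ 𝒥 ∈ (Icc 1 I.J).powerset, ∑ n ∈ s, ((-1 : ℝ) ^ #𝒥 * I.g 𝒥 n) • a n := Finset.sum_comm
    _ = _ := by
        refine Finset.sum_congr rfl fun 𝒥 _ => ?_
        rw [Finset.smul_sum]
        refine Finset.sum_congr rfl fun n _ => ?_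
        rw [mul_smul]

/-- Lemma 5 for real coefficients, in the printed shape `∑ g_𝒥(n) a_n`.
[cite: MatomakiRadziwillAnnals2016, Lemma 5] -/
theorem sum_filter_mem_eq_real (s : Finset ℕ) (a : ℕ → ℝ) :
    ∑ n ∈ s.filter I.Mem, a n =
      ∑ 𝒥 ∈ (Icc 1 I.J).powerset, (-1 : ℝ) ^ #𝒥 * ∑ n ∈ s, I.g 𝒥 n * a n := by
  simpa using I.sum_filter_mem_eq s a

end SieveIntervalSystem

/-- **Matomäki–Radziwiłł 2016, Lemma 5**, paper name (= `SieveIntervalSystem.sum_filter_mem_eq_real`).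
[cite: MatomakiRadziwillAnnals2016, Lemma 5] -/
theorem MatomakiRadziwill2016_lemma5 {η X : ℝ} (I : SieveIntervalSystem η X) (s : Finset ℕ)
    (a : ℕ → ℝ) :
    ∑ n ∈ s.filter I.Mem, a n =
      ∑ 𝒥 ∈ (Icc 1 I.J).powerset, (-1 : ℝ) ^ #𝒥 * ∑ n ∈ s, I.g 𝒥 n * a n :=
  I.sum_filter_mem_eq_real s a

/-! ### Theorem 3 and Proposition 1 (named facts) -/

/-- NAMED FACT — **Matomäki–Radziwiłł 2016, Theorem 3** (as printed: "Let `f : ℕ → [-1,1]` be a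
multiplicative function. Let `𝒮 = 𝒮_X` be as above with `η ∈ (0, 1/6)`. If `[P_1, Q_1] ⊂ [1, h]`,
then for all `X > X(η)` large enough
`(1/X) ∫_X^{2X} |(1/h) ∑_{x ≤ n ≤ x+h, n ∈ 𝒮} f(n) - (1/X) ∑_{X ≤ n ≤ 2X, n ∈ 𝒮} f(n)|² dx
 ≪ (log h)^{1/3} / P_1^{1/6-η} + (log X)^{-1/50}`.")  Rendering: the system of intervals is a
`SieveIntervalSystem η X` (which carries `1 ≤ P_1`), `Q_1 ≤ h`; `n ∈ 𝒮` is the predicate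
`SieveIntervalSystem.Mem`; for real `x` the integers of `[x, x+h]` are `Icc ⌈x⌉₊ ⌊x+h⌋₊`; "`≪`" and
"`X > X(η)`" become `∃ C X₀` after `η` is fixed.  The theorem is a step in the proof of Theorem 1,
whose range is `2 ≤ h ≤ X`; the bound `h ≤ X` is implicit in the source (for `h/X → ∞` the left-hand
side does not tend to `0`) and is recorded explicitly.
Users take `(h : MatomakiRadziwill2016_theorem3)`. [cite: MatomakiRadziwillAnnals2016, Theorem 3] -/
def MatomakiRadziwill2016_theorem3 : Prop :=
  ∀ η : ℝ, 0 < η → η < 1 / 6 → ∃ C X₀ : ℝ,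
    ∀ f : ArithmeticFunction ℝ, f.IsMultiplicative → (∀ n, |f n| ≤ 1) →
    ∀ X h : ℝ, X₀ ≤ X → h ≤ X → ∀ I : SieveIntervalSystem η X, I.Q 1 ≤ h →
      X⁻¹ * ∫ x in X..2 * X,
          (h⁻¹ * ∑ n ∈ (Icc ⌈x⌉₊ ⌊x + h⌋₊).filter I.Mem, f n
            - X⁻¹ * ∑ n ∈ (Icc ⌈X⌉₊ ⌊2 * X⌋₊).filter I.Mem, f n) ^ 2
        ≤ C * (Real.log h ^ (1 / 3 : ℝ) / I.P 1 ^ (1 / 6 - η) + 1 / Real.log X ^ (1 / 50 : ℝ))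

/-- NAMED FACT — **Matomäki–Radziwiłł 2016, Proposition 1** (as printed: "Let `f : ℕ → [-1,1]` be a
multiplicative function. Let `𝒮` be a set of integers as defined in Section 2. Let
`F(s) = ∑_{X ≤ n ≤ 2X, n ∈ 𝒮} f(n) n^{-s}`. Then, for any `T`,
`∫_{(log X)^{1/15}}^{T} |F(1+it)|² dt ≪ (T/(X/Q_1) + 1) ((log Q_1)^{1/3} / P_1^{1/6-η} + (log X)^{-1/50})`.")
Rendering as in `MatomakiRadziwill2016_theorem3` (`SieveIntervalSystem η X`, predicate `Mem`,
`∃ C X₀` after `η ∈ (0, 1/6)` is fixed — the "`X > X(η)`" of Theorem 3, which the proposition serves);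
"any `T`" is any `T ≥ (log X)^{1/15}` (the lower limit of the integral).
Users take `(h : MatomakiRadziwill2016_prop1)`. [cite: MatomakiRadziwillAnnals2016, Proposition 1] -/
def MatomakiRadziwill2016_prop1 : Prop :=
  ∀ η : ℝ, 0 < η → η < 1 / 6 → ∃ C X₀ : ℝ,
    ∀ f : ArithmeticFunction ℝ, f.IsMultiplicative → (∀ n, |f n| ≤ 1) →
    ∀ X : ℝ, X₀ ≤ X → ∀ I : SieveIntervalSystem η X, ∀ T : ℝ, Real.log X ^ (1 / 15 : ℝ) ≤ T →
      ∫ t in Real.log X ^ (1 / 15 : ℝ)..T,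
          ‖∑ n ∈ (Icc ⌈X⌉₊ ⌊2 * X⌋₊).filter I.Mem,
              (f n : ℂ) * (n : ℂ) ^ (-(1 + (t : ℂ) * Complex.I))‖ ^ 2
        ≤ C * (T / (X / I.Q 1) + 1)
            * (Real.log (I.Q 1) ^ (1 / 3 : ℝ) / I.P 1 ^ (1 / 6 - η) + 1 / Real.log X ^ (1 / 50 : ℝ))

end Literature.NumberTheory.Sieve
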